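import Summits.BirchSwinnertonDyer.BirchSwinnertonDyer.Theorems.KatoDescentPotSupersingularKatoFiniteLevelStrictKato1416
import Summits.BirchSwinnertonDyer.Rank1Residual.GaloisImage.InertiaInvariantsFrobeniusKernel
import Literature.NumberTheory.EllipticCurves.InertiaInvariantsAdditiveProofs
import Literature.NumberTheory.EllipticCurves.TateModuleFixedPointsProofs
import Literature.NumberTheory.EllipticCurves.TateModulePrimaryFiniteProofs
import Literature.NumberTheory.EllipticCurves.TateModuleContinuityProofs
import HarnessLib

/-!
# Kato's (14.9.3) at finite level, part 22: the inertia-invariants hypothesis DISCHARGED at the ADDITIVE places —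
# `E[p^∞]^{I_v}` is finite at every finite `v ∤ p` of additive reduction (`V_pE^{I_v} = 0`, Silverman *ATAEC* IV.10.2(a))
# (route `KatoDescentPotSupersingular` / `…Tame…`, crux M = stmt-BirchSwinnertonDyer-19196; route-free helper)

Seat `bsd-potss-rkm` g18 (prover; cell `bsd-potss`), item stmt-BirchSwinnertonDyer-19196 (`--supports … --as helper`; closes
nothing).  HONEST FRAMING: BSD is not proved by any of this; nothing is booked; theorems only (no definition, no named fact).

Parts 13–21 (rkm g17) of this family carry the hypothesis
`hI : Set.Finite {x : E[p^∞] | ∀ τ ∈ I_{K_v}, τ • x = x}` at the places `v ∈ T ∖ {v_p}` — the finiteness of the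
inertia invariants of `E[p^∞]`, under which `#H¹_ur(K_v, E[p^∞]) = #E(K_v)[p^∞]` (parts 13–14, Milne *ADT* I 2.9).  This file
DISCHARGES it at every finite place `v ∤ p` of ADDITIVE reduction (the places of crux M's curves other than `p` may also be
multiplicative; those are served by n1011's `InertiaDivisible*` files and are NOT claimed here):

* `finrank_tateModule_inertiaFixedPoints_eq_zero_of_hasAdditiveReductionAt` — `rank_{ℤ_p} T_p(E(K̄)^{I_𝔓}) = 0` for every
  prime `𝔓 ∣ v` of `\bar ℤ_K`: the tree THEOREM `codimFixed_inertia_rationalTate_eq_two_of_hasAdditiveReductionAt_holds`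
  (Silverman *ATAEC* IV.10.2(a), additive case, proved in the tree from Kodaira–Néron) says `codim (V_pE)^{I_𝔓} = 2`, and
  `codim (V_pE)^H = 2 − rank T_p(E(K̄)^H)` (`codimFixed_rationalTate_eq_two_sub`, rank `≤ 2`);
* `finite_primaryComponent_inertiaFixedPoints_of_hasAdditiveReductionAt` — hence `(E(K̄)^{I_𝔓})[p^∞]` is FINITE
  (`TateModule.finite_primaryComponent_iff_finrank_eq_zero`: for `A[p]` finite, `A[p^∞]` finite iff `T_pA = 0` — the
  `p`-divisible core of an infinite `p`-primary group with finite socle carries a non-zero Tate vector);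
* `finite_setOf_inertia_fixed_primary_of_hasAdditiveReductionAt` — the hypothesis `hI` of parts 13–21 in its own currency
  (`I_{𝔓₀} = res I_{K_v}`, `InertiaDivisible.forall_inertia_adicCompletionPrime_smul_eq_iff`);
* `natCard_unramifiedSubgroup_primary_eq_natCard_primaryComponent_of_hasAdditiveReductionAt` —
  **`#H¹_ur(K_v, E[p^∞]) = #E(K_v)[p^∞]`** at additive `v ∤ p` (parts 13–14 with the hypothesis gone);
* `natCard_integralH1_quot_le_sha_points_of_additive` — part 19's NET bound over `ℚ` for curves all of whose bad
  places `≠ v_p` in `T` are additive, hypothesis-free but for the Poitou–Tate input `SelmerComplement`: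
  `#(A ⧸ (A ∩ p^kH¹(⊤,T_pE))) ≤ #Ш(E/ℚ)[p^∞] · ∏_{ℓ∈T∖{v_p}} #E(ℚ_ℓ)[p^∞] · #E(ℚ_p)[p^k] · p^k` (`k ≫ 0`).

References: J. H. Silverman, *ATAEC* Thm. IV.10.2(a) and its proof (PDF pp. 358–359) [SilvermanATAEC1994]; J.-P. Serre,
J. Tate, *Good reduction of abelian varieties* (1968) §1 [SerreTate1968]; J. S. Milne, *ADT* I Lemma 2.9 [MilneADT2006];
K. Kato, Astérisque 295 (2004) §14.8, Prop. 14.16 [Kato2004Asterisque].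
-/

-- the summit and its single problem are both named `BirchSwinnertonDyer` (registry layout D-0017)
set_option linter.dupNamespace false
set_option autoImplicit false

noncomputable section

open scoped Classical ContRepresentation NumberField AddSubgroup
open Function Field NumberField IsDedekindDomain WeierstrassCurve
open Literature.NumberTheory.EllipticCurves Literature.NumberTheory.GaloisRepresentations
  Literature.NumberTheory.GaloisRepresentations.DiscreteGaloisModule Literature.NumberTheory.GaloisCohomology
open Literature.NumberTheory.EllipticCurves.Kato2004 Literature.NumberTheory.EllipticCurves.Kato2004.EulerSystemValues
open Summit.BirchSwinnertonDyer.Rank1Residual.X11b.LocBridge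
open Summit.BirchSwinnertonDyer.Rank1Residual.GaloisImage

namespace Summit.BirchSwinnertonDyer.BirchSwinnertonDyer.Theorems.KatoFiniteLevelCount

/-! ## §1 `T_p(E(K̄)^{I_𝔓}) = 0` and `(E(K̄)^{I_𝔓})[p^∞]` finite at an additive place `v ∤ p` -/

section Additive

variable {K : Type} [Field K] [NumberField K] (W : WeierstrassCurve K) [W.IsElliptic] (p : ℕ) [Fact p.Prime]

/-- **`rank_{ℤ_p} T_p(E(K̄)^{I_𝔓}) = 0` at a place `v ∤ p` of additive reduction**, for every prime `𝔓 ∣ v` of `\bar ℤ_K`: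
Silverman *ATAEC* IV.10.2(a) (additive case, tree theorem `codimFixed_inertia_rationalTate_eq_two_of_hasAdditiveReductionAt_holds`:
`codim (V_pE)^{I_𝔓} = 2`) read through `codim (V_pE)^H = 2 − rank T_p(E(K̄)^H)` (`codimFixed_rationalTate_eq_two_sub`).
[cite: SilvermanATAEC1994, Thm. IV.10.2(a) and its proof (PDF pp. 358–359)] -/
theorem finrank_tateModule_inertiaFixedPoints_eq_zero_of_hasAdditiveReductionAt {v : HeightOneSpectrum (𝓞 K)}
    (hpv : (p : 𝓞 K) ∉ v.asIdeal) (hadd : W.HasAdditiveReductionAt v)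
    {𝔓 : Ideal (absIntegers (𝓞 K) K)} (h𝔓 : 𝔓 ∈ v.primesAbove) :
    Module.finrank ℤ_[p]
        (TateModule (FixedPoints.addSubgroup (𝔓.inertia (absoluteGaloisGroup K)) (geomPoints W)) p) = 0 := by
  have h : Continuous fun x : absoluteGaloisGroup K × RationalTateModule (geomPoints W) p =>
      rationalTateRepresentation (absoluteGaloisGroup K) (geomPoints W) p x.1 x.2 :=
    W.continuous_rationalGaloisRepTate_holds p
  have hp0 : (p : K) ≠ 0 := by exact_mod_cast (Fact.out : p.Prime).ne_zero
  have hcodim := W.codimFixed_inertia_rationalTate_eq_two_of_hasAdditiveReductionAt_holds p h v hpv hadd h𝔓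
  rw [W.codimFixed_rationalTate_eq_two_sub p hp0 h] at hcodim
  have hle := W.finrank_tateModule_fixedPoints_le_two p hp0 (𝔓.inertia (absoluteGaloisGroup K))
  omega

/-- **`(E(K̄)^{I_𝔓})[p^∞]` is FINITE at a place `v ∤ p` of additive reduction** (every prime `𝔓 ∣ v`): `T_p(E(K̄)^{I_𝔓}) = 0`
(`finrank_tateModule_inertiaFixedPoints_eq_zero_of_hasAdditiveReductionAt`) and, the `p`-torsion `E(K̄)[p]` being finite, an
infinite `p`-primary part would carry a non-zero Tate vector (`TateModule.finite_primaryComponent_iff_finrank_eq_zero`).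
This is Silverman's geometric input *"`V_ℓ(E(K^nr)) = 0`"* in its integral form `#E(K_v^nr)[p^∞] < ∞`.
[cite: SilvermanATAEC1994, proof of Thm. IV.10.2(a) (PDF p. 359)] -/
theorem finite_primaryComponent_inertiaFixedPoints_of_hasAdditiveReductionAt {v : HeightOneSpectrum (𝓞 K)}
    (hpv : (p : 𝓞 K) ∉ v.asIdeal) (hadd : W.HasAdditiveReductionAt v)
    {𝔓 : Ideal (absIntegers (𝓞 K) K)} (h𝔓 : 𝔓 ∈ v.primesAbove) :
    Finite (AddCommGroup.primaryComponent
      (FixedPoints.addSubgroup (𝔓.inertia (absoluteGaloisGroup K)) (geomPoints W)) p) := by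
  have hfinp : Finite ((FixedPoints.addSubgroup (𝔓.inertia (absoluteGaloisGroup K)) (geomPoints W))[(p : ℕ)]) :=
    finite_torsionBy_of_injective (FixedPoints.addSubgroup (𝔓.inertia (absoluteGaloisGroup K)) (geomPoints W)).subtype
      (fun _ _ h => Subtype.ext h) _ (W.finite_geomTorsion_prime p)
  exact (TateModule.finite_primaryComponent_iff_finrank_eq_zero hfinp).mpr
    (finrank_tateModule_inertiaFixedPoints_eq_zero_of_hasAdditiveReductionAt W p hpv hadd h𝔓)

/-- **The hypothesis `hI` of parts 13–21, discharged at an additive place `v ∤ p`**: the points of `E[p^∞]` fixed by the local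
inertia group `I_{K_v}` (acting through `res : Γ_{K_v} → Γ_K`, i.e. through `GaloisRep.toLocal`) form a FINITE set — they are
the points fixed by `I_{𝔓₀}` for the prime `𝔓₀ ∣ v` cut out by the chosen embedding (`I_{𝔓₀} = res I_{K_v}`,
`InertiaDivisible.forall_inertia_adicCompletionPrime_smul_eq_iff`), a subset of the finite `(E(K̄)^{I_{𝔓₀}})[p^∞]`.
[cite: SilvermanATAEC1994, proof of Thm. IV.10.2(a) (PDF p. 359)] [cite: NeukirchANT1999, Ch. II §9 Prop. (9.6)] -/
theorem finite_setOf_inertia_fixed_primary_of_hasAdditiveReductionAt {v : HeightOneSpectrum (𝓞 K)}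
    (hpv : (p : 𝓞 K) ∉ v.asIdeal) (hadd : W.HasAdditiveReductionAt v) :
    Set.Finite {x : W.geomPrimaryTorsion p |
      ∀ τ ∈ absInertia (v.adicCompletion K), GaloisRep.toLocal v (primaryGaloisModule W p) τ x = x} := by
  set H : Subgroup (absoluteGaloisGroup K) := (adicCompletionPrime K v).inertia (absoluteGaloisGroup K) with hH
  haveI hfin := finite_primaryComponent_inertiaFixedPoints_of_hasAdditiveReductionAt W p hpv hadd
    (adicCompletionPrime_mem_primesAbove K v)
  -- the map into `(E(K̄)^{I_{𝔓₀}})[p^∞]`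
  have hmem : ∀ x : W.geomPrimaryTorsion p,
      (∀ τ ∈ absInertia (v.adicCompletion K), GaloisRep.toLocal v (primaryGaloisModule W p) τ x = x) →
        ((x : geomPoints W) ∈ FixedPoints.addSubgroup H (geomPoints W)) := by
    intro x hx
    have hx' : ∀ τ ∈ absInertia (v.adicCompletion K), absGaloisRestrict K (v.adicCompletion K) τ • x = x := hx
    have hI := (InertiaDivisible.forall_inertia_adicCompletionPrime_smul_eq_iff W p v x).mpr hx'
    rw [FixedPoints.mem_addSubgroup]
    rintro ⟨i, hi⟩
    have := congrArg (fun z : W.geomPrimaryTorsion p => (z : geomPoints W)) (hI i hi)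
    simpa using this
  let F : {x : W.geomPrimaryTorsion p |
      ∀ τ ∈ absInertia (v.adicCompletion K), GaloisRep.toLocal v (primaryGaloisModule W p) τ x = x} →
      AddCommGroup.primaryComponent (FixedPoints.addSubgroup H (geomPoints W)) p :=
    fun x => ⟨⟨((x : W.geomPrimaryTorsion p) : geomPoints W), hmem x.1 x.2⟩, by
      obtain ⟨n, hn⟩ := (AddCommGroup.mem_primaryComponent).mp (x : W.geomPrimaryTorsion p).2
      exact (AddCommGroup.mem_primaryComponent).mpr ⟨n, Subtype.ext (by simpa using hn)⟩⟩
  refine Set.finite_coe_iff.mp (Finite.of_injective F fun a b hab => ?_)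
  have h := congrArg (fun z => ((z : FixedPoints.addSubgroup H (geomPoints W)) : geomPoints W)) (congrArg Subtype.val hab)
  exact Subtype.ext (Subtype.ext h)

/-- **`#H¹_ur(K_v, E[p^∞]) = #E(K_v)[p^∞]` at a place `v ∤ p` of ADDITIVE reduction** — parts 13–14
(`natCard_unramifiedSubgroup_primary_eq_natCard_primaryComponent`, Milne *ADT* I 2.9 + `#H⁰(K_v,E[p^∞]) = #E(K_v)[p^∞]`) with
their finiteness hypothesis discharged by `finite_setOf_inertia_fixed_primary_of_hasAdditiveReductionAt`.  The order of Kato's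
§14.8 summand `H¹(𝔽_v, H⁰(K_v^{nr}, E[p^∞]))` at an additive place.
[cite: Kato2004Asterisque, §14.8 (p. 238)] [cite: MilneADT2006, Ch. I, Lemma 2.9] [cite: SilvermanATAEC1994, Thm. IV.10.2(a)] -/
theorem natCard_unramifiedSubgroup_primary_eq_natCard_primaryComponent_of_hasAdditiveReductionAt
    (v : HeightOneSpectrum (𝓞 K)) (hpv : (p : 𝓞 K) ∉ v.asIdeal) (hadd : W.HasAdditiveReductionAt v) :
    Nat.card (unramifiedSubgroup (GaloisRep.toLocal v (primaryGaloisModule W p)) 1) =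
      Nat.card (AddCommGroup.primaryComponent (W.baseChange (v.adicCompletion K)).toAffine.Point p) :=
  natCard_unramifiedSubgroup_primary_eq_natCard_primaryComponent W p v
    (finite_setOf_inertia_fixed_primary_of_hasAdditiveReductionAt W p hpv hadd)

omit [W.IsElliptic] in
/-- Additive reduction at `v` from "neither good nor multiplicative" (Mathlib's trichotomy for the minimal model at `v`).
[cite: SilvermanAEC2009, Prop. VII.5.1] -/
theorem hasAdditiveReductionAt_of_not_good_of_not_mult (v : HeightOneSpectrum (𝓞 K))
    (hg : ¬ W.HasGoodReductionAt v) (hm : ¬ W.HasMultiplicativeReductionAt v) : W.HasAdditiveReductionAt v := by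
  rcases hasGoodReduction_or_hasMultiplicativeReduction_or_hasAdditiveReduction
      (R := v.adicCompletionIntegers K) (W := W.localMinimalModel v) with h | h | h
  · exact (hg h).elim
  · exact (hm h).elim
  · exact h

end Additive

/-! ## §2 Part 21's NET bound over `ℚ` with the inertia hypothesis discharged (bad places `≠ v_p` in `T` all additive) -/

section Rat

variable (W : WeierstrassCurve ℚ) [W.IsElliptic] (p : ℕ) [Fact p.Prime] [ContinuousSMul ℤ_[p] (W.tateModule p)]

/-- **Part 19 (`natCard_integralH1_quot_le_sha_points`) for a curve whose places in `T ∖ {v_p}` are ADDITIVE**: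
`E/ℚ` elliptic, `p` odd, rank `0` (`[Finite W.toAffine.Point]`), `Ш[p^∞]` finite, `T ∋ v_p` finite with good reduction
outside `T` and ADDITIVE reduction at every `v ∈ T ∖ {v_p}`, and the Poitou–Tate input `SelmerComplement` for THE invariant
maps ⟹ `∃ k₀ ∀ k ≥ k₀`,
`#(A ⧸ (A ∩ p^k·H¹(⊤,T_pE))) ≤ #Ш(E/ℚ)[p^∞] · ∏_{ℓ∈T∖{v_p}} #E(ℚ_ℓ)[p^∞] · (#E(ℚ_p)[p^k] · p^k)`,
`A = Kato2004.integralH1 (tateRep W p) p ⊤` (Kato's `H¹(ℤ[1/p], T_pE)`).  No inertia hypothesis remains.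
[cite: Kato2004Asterisque, §14.8 (p. 238), (14.9.3) (p. 240), Prop. 14.16 (pp. 244–245)] [cite: SilvermanATAEC1994, Thm. IV.10.2(a)] -/
theorem natCard_integralH1_quot_le_sha_points_of_additive (hodd : p ≠ 2)
    (T : Finset (HeightOneSpectrum (𝓞 ℚ))) (hpT : primePlace p ∈ T)
    (hT : ∀ v : HeightOneSpectrum (𝓞 ℚ), v ∉ T → W.HasGoodReductionAt v)
    (hadd : ∀ v ∈ T \ {primePlace p}, W.HasAdditiveReductionAt v)
    [Finite W.toAffine.Point] [Finite (AddCommGroup.primaryComponent W.sha p)]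
    (hSC : ∀ k : ℕ, (LocalInvariants.canonical ℚ (p ^ k)).SelmerComplement) :
    ∃ k₀ : ℕ, ∀ k, k₀ ≤ k →
      Nat.card (integralH1 (tateRep W p) p ⊤ ⧸
          AddSubgroup.comap (integralH1 (tateRep W p) p ⊤).toAddSubgroup.subtype
            (LinearMap.range (DistribSMul.toLinearMap ℤ_[p] (H1 (tateRep W p) ⊤)
              ((p : ℤ_[p]) ^ k))).toAddSubgroup) ≤
        Nat.card (AddCommGroup.primaryComponent W.sha p) *
          (∏ v ∈ T \ {primePlace p},
            Nat.card (AddCommGroup.primaryComponent (W.baseChange (v.adicCompletion ℚ)).toAffine.Point p)) *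
          (Nat.card (nsmulAddMonoidHom (p ^ k) :
            (W.baseChange ((primePlace p).adicCompletion ℚ)).toAffine.Point →+ _).ker * p ^ k) :=
  natCard_integralH1_quot_le_sha_points W p hodd T hpT hT
    (fun v hv => finite_setOf_inertia_fixed_primary_of_hasAdditiveReductionAt W p
      (natCast_not_mem_of_ne_primePlace p (v := v) (by
        intro h; rw [Finset.mem_sdiff, Finset.mem_singleton] at hv; exact hv.2 h))
      (hadd v hv))
    hSC

end Rat

end Summit.BirchSwinnertonDyer.BirchSwinnertonDyer.Theorems.KatoFiniteLevelCount

end
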